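import Literature.MathematicalPhysics.QuantumFieldTheory.BalabanImbrieJaffe1984to88.BIJ88TwoSpeciesPolymerGas

/-!
# `BalabanImbrieJaffe1984to88.BIJ88Eq5134PolymerGas` — T. Bałaban, J. Imbrie, A. Jaffe, *Effective action and cluster properties of the abelian
Higgs model*, Commun. Math. Phys. **114** (1988) 257–315 [BalabanImbrieJaffe1988], §5.13 display (5.13.4) p. 306 [PDF 50] and §5.14 p. 308
[PDF 52]: **the resummed expansion (5.13.4) as a POLYMER GAS, II: the identities** — the honest two-species form of the right side of (5.13.4)
(`BIJ88Eq5134TwoSpecies.exchange5134`) IS the partition function of the typed polymer gas of `BIJ88TwoSpeciesPolymerGas`, normalized by the product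
of the one-region Mayer sums; over `ℂ` it is literally `Literature.Probability.LatticeModels.polymerPartitionFunction`, the object to which the
step of p. 308, verbatim *"z_F(Λ₁₂^{(k)}) = (z_F(Λ₁₂^{(k)})/z(Λ₁₂^{(k)})) exp(log z(Λ₁₂^{(k)}))"* … *"we give expansions for z_F/z and log z"*, applies.

statement-level skeleton of published theorems with citation tags; proofs where landed; nothing here is a claim about the Yang–Mills mass gap

PDF held: `paper:balaban1988-cmp114-bij-abelian-higgs-effective-action` (journal page = PDF page + 256); p. 306 = PDF 50, p. 308 = PDF 52.

**The print (verbatim).** p. 306 [PDF 50]: *"… = e^{−V^{(k)}_{const}(Λ₈^{(k)})} Σ_{{X_α}} Π_α g₂(X_α). (5.13.4) Here g₂(X_α) is obtained by summing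
over S_Y, S₅ compatible with X_α … g₂(X_α) = Σ_{S_Y,S₅ compatible with X_α} g₁(X_α)."* p. 308 [PDF 52]: *"To extract the perturbative terms, we
resum the decoupling and Mayer expansions in Λ₁₂^{(k)}. … We treat z_F(Λ₁₂^{(k)}) as follows: z_F(Λ₁₂^{(k)}) = (z_F(Λ₁₂^{(k)})/z(Λ₁₂^{(k)}))
exp(log z(Λ₁₂^{(k)})), where z(Λ₁₂^{(k)}) = z_{F=1}(Λ₁₂^{(k)})"*.

WHAT IS REPRODUCED (unit `lit-balaban-p25`, generation 9 of the Phase-2 proof seat p25; SKELETON rows `C2.Eq5.13.3-5.13.4` and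
`C2.Eq5.14.1-5.14.2`; HOME `run/shared/lean/pub/lit-balaban/lit-balaban-p25/`), theorems only, in the vocabulary of `BIJ88TwoSpeciesPolymerGas`
(`tpolys`, `tinc`, `twt`, `uncov`):
* §1 the elementary regions split into the uncovered ones and those inside the supports of a compatible typed family (`regions_eq_uncov_union`,
  `disjoint_uncov_biUnion`, `pairwiseDisjoint_filter_subset`);
* §2 **`twoSpecies_eq_typedGas`**: for arbitrary weights `a b` in a commutative ring,
  `Σ_{Q J₀-closed filling} Σ_{M ⊆ Q hard core} Π_M b Π_{Q∖M} a = Σ_{𝒳 ⊆ tpolys compatible} Π_{p∈𝒳} twt a b p · Π_{□ uncovered} a(□)` (background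
  form, by the bijection of the companion file); **`twoSpecies_eq_typedGas_norm`**: with `a(□) u(□) = 1` on the elementary regions,
  `= Π_□ a(□) · Σ_{𝒳 compatible} Π_p (twt a b p · Π_{□ ⊆ p} u(□))` (activities relative to the product background);
  **`twoSpecies_eq_polymerPartitionFunction`**: over `ℂ` the last sum is `polymerPartitionFunction (tinc adj) ŵ (tpolys J₀ W)`;
* §3 back to (5.13.4): on a single elementary region the local regions of any inner Mayer set are that region (`localI_of_mem_regions`), so
  `g₂ᴮ(□) = 0` and `g₂ᴬ(□) = g₂(□)` (`gB_of_mem_regions`, `gA_of_mem_regions`) — the background is the product of the one-region Mayer sums;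
  **`exchange5134_typedGas`** (the `S`-summed left side of (5.13.4) as the typed gas with background `Π g₂(□)`) and
  **`exchange5134_polymerPartitionFunction`** (over `ℂ`, `g₂(□) ≠ 0`: `= Π_□ g₂(□) · Ξ_{tpolys}(tinc; ŵ)`, `ŵ(X,τ) = g₂^τ(X) / Π_{□⊆X} g₂(□)`).

**Reading note (GAPS.md G-C2-p25-03, continued).** With the two species and the B–B hard core of the honest bookkeeping, (5.13.4) summed over the
Mayer data is `Π_□ g₂(□)` times an honest polymer partition function with a reflexive symmetric pair incompatibility; the expansion of its `log`
(p. 308, (5.14.2)) is the standard one once the relative activities `g₂ᴬ(X)/Π g₂(□)` (`X` of ≥ 2 regions) and `g₂ᴮ(X)/Π g₂(□)` are small — a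
smallness this file does not assert. NOT summit progress; NOT continuum; NOT Clay. Imports: `BIJ88TwoSpeciesPolymerGas` only; modifies nothing.
Cell `lit-balaban` Phase 2, seat p25 gen 9; rows C2.Eq5.13.3-5.13.4 / C2.Eq5.14.1-5.14.2 (owner r16, referee ref-5).
-/

open Finset
open Literature.Probability.LatticeModels (IsSetPartition setPartitions mem_setPartitions IsCompatible polymerPartitionFunction)
open Literature.MathematicalPhysics.QuantumFieldTheory.BalabanImbrieJaffe1984to88.BIJ88ElementaryRegions304
  (IsClosed region regions mem_region mem_region_self region_subset region_subset_of_isClosed isClosed_region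
   region_eq_of_mem isSetPartition_regions mem_regions region_mem_regions regions_restrict_region)
open Literature.MathematicalPhysics.QuantumFieldTheory.BalabanImbrieJaffe1984to88.BIJ88Resummation5141
  (polysIn mem_polysIn restrictTo mem_restrictTo g2)
open Literature.MathematicalPhysics.QuantumFieldTheory.BalabanImbrieJaffe1984to88.BIJ88PolymerRep5134 (IsAdmissible)
open Literature.MathematicalPhysics.QuantumFieldTheory.BalabanImbrieJaffe1984to88.BIJ88MayerExchange5134
  (radj HardCore localI IsMulti gA gB not_isMulti_iff isClosed_union_iff restrictTo_union)
open Literature.MathematicalPhysics.QuantumFieldTheory.BalabanImbrieJaffe1984to88.BIJ88Eq5134TwoSpecies (exchange5134)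
open Literature.MathematicalPhysics.QuantumFieldTheory.BalabanImbrieJaffe1984to88.BIJ88TwoSpeciesPolymerGas

namespace Literature.MathematicalPhysics.QuantumFieldTheory.BalabanImbrieJaffe1984to88.BIJ88Eq5134PolymerGas

variable {ι : Type*} [DecidableEq ι]

section Gas

variable {adj : ι → ι → Prop} [DecidableRel adj] {J₀ : Finset (Finset ι)} {W : Finset ι} {R : Type*} [CommRing R]

/-! ## §1 The elementary regions relative to a compatible typed family -/

/-- **the elementary regions split into the uncovered ones and the ones inside the supports** of a typed family (closed supports are unions
of regions). [cite: BalabanImbrieJaffe1988, (5.13.4) p.306] -/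
theorem regions_eq_uncov_union {𝒳 : Finset (Finset ι × Bool)} (h𝒳 : 𝒳 ⊆ tpolys J₀ W) :
    regions J₀ W = uncov J₀ W 𝒳 ∪ 𝒳.biUnion fun p => (regions J₀ W).filter (· ⊆ p.1) := by
  ext E
  simp only [mem_union, mem_uncov, mem_biUnion, mem_filter]
  constructor
  · intro hE
    by_cases h : ∀ p ∈ 𝒳, Disjoint E p.1
    · exact Or.inl ⟨hE, h⟩
    · push Not at h
      obtain ⟨p, hp, hEp⟩ := h
      obtain ⟨w, hwE, hwp⟩ := not_disjoint_iff.1 hEp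
      obtain ⟨i, hi, rfl⟩ := mem_regions.1 hE
      obtain ⟨hpW, -, hpc⟩ := (mem_tpolys.1 (h𝒳 hp)).1
      refine Or.inr ⟨p, hp, hE, ?_⟩
      rw [← region_eq_of_mem hi hwE]
      exact region_subset_of_isClosed hpW hwp hpc
  · rintro (⟨hE, -⟩ | ⟨-, -, hE, -⟩) <;> exact hE

/-- the uncovered regions are not inside a support. [cite: BalabanImbrieJaffe1988, (5.13.4) p.306] -/
theorem disjoint_uncov_biUnion (𝒳 : Finset (Finset ι × Bool)) :
    Disjoint (uncov J₀ W 𝒳) (𝒳.biUnion fun p => (regions J₀ W).filter (· ⊆ p.1)) := by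
  refine disjoint_left.2 fun E hEu hEb => ?_
  obtain ⟨hEr, hdis⟩ := mem_uncov.1 hEu
  obtain ⟨p, hp, hEp⟩ := mem_biUnion.1 hEb
  obtain ⟨v, hv⟩ := (isSetPartition_regions J₀ W).nonempty_of_mem hEr
  exact disjoint_left.1 (hdis p hp) hv ((mem_filter.1 hEp).2 hv)

omit [DecidableRel adj] in
/-- in a compatible typed family a region lies inside at most one support. [cite: BalabanImbrieJaffe1988, (5.13.4) p.306] -/
theorem pairwiseDisjoint_filter_subset {𝒳 : Finset (Finset ι × Bool)} (hc : IsCompatible (tinc adj) 𝒳) :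
    (↑𝒳 : Set (Finset ι × Bool)).PairwiseDisjoint fun p => (regions J₀ W).filter (· ⊆ p.1) := by
  intro p hp q hq hne
  show Disjoint ((regions J₀ W).filter (· ⊆ p.1)) ((regions J₀ W).filter (· ⊆ q.1))
  refine disjoint_left.2 fun E hEp hEq => ?_
  obtain ⟨hEr, hEp⟩ := mem_filter.1 hEp
  obtain ⟨-, hEq⟩ := mem_filter.1 hEq
  obtain ⟨v, hv⟩ := (isSetPartition_regions J₀ W).nonempty_of_mem hEr
  exact disjoint_left.1 (ne_of_isCompatible hc hp hq hne).2.1 (hEp hv) (hEq hv)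

/-! ## §2 The honest two-species sum is the partition function of the typed polymer gas -/

variable (adj J₀ W) in
/-- **THE HONEST FORM OF (5.13.4) IS A POLYMER GAS (background form)**: for arbitrary weights `a` (species A) and `b` (species B), the two-species
sum over the fillings of `W` by `J₀`-closed polymers with a hard-core species-B sub-family equals the sum over the COMPATIBLE families of typed
polymers of the typed weights times the background `a` on the uncovered elementary regions. [cite: BalabanImbrieJaffe1988, (5.13.4) p.306] -/
theorem twoSpecies_eq_typedGas (a b : Finset ι → R) :
    ∑ Q ∈ (setPartitions W).filter (fun Q => ∀ X ∈ Q, IsClosed J₀ W X),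
        ∑ M ∈ Q.powerset.filter (HardCore adj), (∏ X ∈ M, b X) * ∏ X ∈ Q \ M, a X =
      ∑ 𝒳 ∈ (tpolys J₀ W).powerset.filter (IsCompatible (tinc adj)),
        (∏ p ∈ 𝒳, twt a b p) * ∏ E ∈ uncov J₀ W 𝒳, a E := by
  rw [sum_sigma']
  refine sum_nbij' (fun x => toGas J₀ W x.1 x.2) (fun 𝒳 => ⟨ofQ J₀ W 𝒳, ofM 𝒳⟩) ?_ ?_ ?_ ?_ ?_
  · rintro ⟨Q, M⟩ hx
    simp only [mem_sigma, mem_filter, mem_setPartitions, mem_powerset] at hx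
    obtain ⟨⟨hQ, hcl⟩, hMQ, hhc⟩ := hx
    exact mem_filter.2 ⟨mem_powerset.2 (toGas_subset_tpolys hQ hcl hMQ), isCompatible_toGas hQ hMQ hhc⟩
  · intro 𝒳 h𝒳
    obtain ⟨h𝒳, hc⟩ := mem_filter.1 h𝒳
    rw [mem_powerset] at h𝒳
    exact mem_sigma.2 ⟨mem_filter.2 ⟨mem_setPartitions.2 (isSetPartition_ofQ h𝒳 hc),
      fun X hX => (nonempty_closed_of_mem_ofQ h𝒳 hX).2.2⟩, mem_filter.2 ⟨mem_powerset.2 (ofM_subset_ofQ 𝒳), hardCore_ofM hc⟩⟩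
  · rintro ⟨Q, M⟩ hx
    simp only [mem_sigma, mem_filter, mem_setPartitions, mem_powerset] at hx
    obtain ⟨⟨hQ, -⟩, hMQ, -⟩ := hx
    exact Sigma.ext (ofQ_toGas hQ hMQ) (heq_of_eq (ofM_toGas Q M))
  · intro 𝒳 h𝒳
    obtain ⟨h𝒳, hc⟩ := mem_filter.1 h𝒳
    exact toGas_ofQ_ofM (mem_powerset.1 h𝒳) hc
  · rintro ⟨Q, M⟩ hx
    simp only [mem_sigma, mem_filter, mem_setPartitions, mem_powerset] at hx
    obtain ⟨⟨hQ, -⟩, hMQ, -⟩ := hx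
    exact (prod_toGas_mul hQ hMQ a b).symm

variable (adj J₀ W) in
/-- **THE HONEST FORM OF (5.13.4) IS A POLYMER GAS (normalized form)**: if `u` inverts the species-A weight on the elementary regions
(`a(□) u(□) = 1`), the two-species sum is the background `Π_□ a(□)` (p. 308: the normalization `z` restricted to single regions) times the sum over
the compatible typed families of the RELATIVE activities `twt a b (X,τ) · Π_{□ ⊆ X} u(□)`. [cite: BalabanImbrieJaffe1988, (5.14.1) p.308] -/
theorem twoSpecies_eq_typedGas_norm (a b u : Finset ι → R) (hu : ∀ E ∈ regions J₀ W, a E * u E = 1) :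
    ∑ Q ∈ (setPartitions W).filter (fun Q => ∀ X ∈ Q, IsClosed J₀ W X),
        ∑ M ∈ Q.powerset.filter (HardCore adj), (∏ X ∈ M, b X) * ∏ X ∈ Q \ M, a X =
      (∏ E ∈ regions J₀ W, a E) *
        ∑ 𝒳 ∈ (tpolys J₀ W).powerset.filter (IsCompatible (tinc adj)),
          ∏ p ∈ 𝒳, (twt a b p * ∏ E ∈ (regions J₀ W).filter (· ⊆ p.1), u E) := by
  rw [twoSpecies_eq_typedGas, mul_sum]
  refine sum_congr rfl fun 𝒳 h𝒳 => ?_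
  obtain ⟨h𝒳, hc⟩ := mem_filter.1 h𝒳
  rw [mem_powerset] at h𝒳
  have hcov : ∀ p ∈ 𝒳, (∏ E ∈ (regions J₀ W).filter (· ⊆ p.1), a E) * ∏ E ∈ (regions J₀ W).filter (· ⊆ p.1), u E = 1 := by
    intro p _
    rw [← prod_mul_distrib]
    exact prod_eq_one fun E hE => hu E (mem_filter.1 hE).1
  have hreg : ∏ E ∈ regions J₀ W, a E =
      (∏ E ∈ uncov J₀ W 𝒳, a E) * ∏ p ∈ 𝒳, ∏ E ∈ (regions J₀ W).filter (· ⊆ p.1), a E := by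
    rw [← prod_biUnion (pairwiseDisjoint_filter_subset hc), ← prod_union (disjoint_uncov_biUnion 𝒳),
      ← regions_eq_uncov_union h𝒳]
  have hsplit : ∏ p ∈ 𝒳, ((∏ E ∈ (regions J₀ W).filter (· ⊆ p.1), a E) *
      (twt a b p * ∏ E ∈ (regions J₀ W).filter (· ⊆ p.1), u E)) =
        (∏ p ∈ 𝒳, ∏ E ∈ (regions J₀ W).filter (· ⊆ p.1), a E) *
          ∏ p ∈ 𝒳, (twt a b p * ∏ E ∈ (regions J₀ W).filter (· ⊆ p.1), u E) := prod_mul_distrib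
  calc (∏ p ∈ 𝒳, twt a b p) * ∏ E ∈ uncov J₀ W 𝒳, a E
      = (∏ E ∈ uncov J₀ W 𝒳, a E) * ∏ p ∈ 𝒳, ((∏ E ∈ (regions J₀ W).filter (· ⊆ p.1), a E) *
          (twt a b p * ∏ E ∈ (regions J₀ W).filter (· ⊆ p.1), u E)) := by
        rw [mul_comm]
        congr 1
        refine prod_congr rfl fun p hp => ?_
        rw [mul_left_comm, hcov p hp, mul_one]
    _ = (∏ E ∈ regions J₀ W, a E) * ∏ p ∈ 𝒳, (twt a b p * ∏ E ∈ (regions J₀ W).filter (· ⊆ p.1), u E) := by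
        rw [hsplit, ← mul_assoc, ← hreg]

variable (adj J₀ W) in
/-- **… and over `ℂ` it is LITERALLY `polymerPartitionFunction`** of `Literature.Probability.LatticeModels.PolymerGas` (Fernández–Procacci's
`Ξ_Λ(z) = Σ_{compatible} Π z`) for the typed polymers, the incompatibility `tinc` and the relative activities — the object whose `log` the
convergent polymer expansion controls (p. 308 *"exp(log z(Λ₁₂))"*, (5.14.2)). [cite: BalabanImbrieJaffe1988, (5.14.1) p.308] -/
theorem twoSpecies_eq_polymerPartitionFunction (a b u : Finset ι → ℂ) (hu : ∀ E ∈ regions J₀ W, a E * u E = 1) :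
    ∑ Q ∈ (setPartitions W).filter (fun Q => ∀ X ∈ Q, IsClosed J₀ W X),
        ∑ M ∈ Q.powerset.filter (HardCore adj), (∏ X ∈ M, b X) * ∏ X ∈ Q \ M, a X =
      (∏ E ∈ regions J₀ W, a E) *
        polymerPartitionFunction (tinc adj) (fun p => twt a b p * ∏ E ∈ (regions J₀ W).filter (· ⊆ p.1), u E) (tpolys J₀ W) := by
  rw [twoSpecies_eq_typedGas_norm adj J₀ W a b u hu, polymerPartitionFunction, sum_filter]


end Gas

/-! ## §3 Back to (5.13.4): the background is the product of the one-region Mayer sums -/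

section Application

variable (adj : ι → ι → Prop) [DecidableRel adj] (J₀ Ys : Finset (Finset ι)) (W : Finset ι) {R : Type*} [CommRing R]

/-- **an elementary region is ONE local region for every inner Mayer set**: the joining sets being sets of cubes of `W`, for `□ ∈ regions J₀ W`
and Mayer polymers `T` inside `□`, `localI J₀ □ T = {□}` (rules (i)–(ii) only merge further). [cite: BalabanImbrieJaffe1988, p.304 (Sect. 5.13)] -/
theorem localI_of_mem_regions (hJ₀ : ∀ Y ∈ J₀, Y ⊆ W) {E : Finset ι} (hE : E ∈ regions J₀ W) {T : Finset (Finset ι)}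
    (hT : ∀ Y ∈ T, Y ⊆ E) : localI J₀ E T = {E} := by
  have hEW : E ⊆ W := (isSetPartition_regions J₀ W).subset hE
  have hTE : restrictTo T E = T := filter_true_of_mem hT
  have hE' : E ∈ regions (J₀ ∪ T) W := by
    obtain ⟨i, hi, rfl⟩ := mem_regions.1 hE
    refine mem_regions.2 ⟨i, hi, Subset.antisymm ?_ fun j hj => ?_⟩
    · refine region_subset_of_isClosed hEW (mem_region_self hi)
        (isClosed_union_iff.2 ⟨isClosed_region J₀ W i, fun Y hY _ y hy => hT Y hY (mem_inter.1 hy).1⟩)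
    · exact mem_region.2 ⟨hEW hj, fun T' hT' hiT' hc => (mem_region.1 hj).2 T' hT' hiT' (isClosed_union_iff.1 hc).1⟩
  rw [localI, ← hTE, ← restrictTo_union]
  exact regions_restrict_region (fun Y hY => (mem_union.1 hY).elim (hJ₀ Y) fun h => (hT Y h).trans hEW) hE'

/-- **`g₂ᴮ(□) = 0` on a single elementary region** (no inner Mayer data makes it multi-region): the species-B typed polymers on single regions
carry zero weight in (5.13.4). [cite: BalabanImbrieJaffe1988, (5.13.4) p.306] -/
theorem gB_of_mem_regions (hJ₀ : ∀ Y ∈ J₀, Y ⊆ W) {E : Finset ι} (hE : E ∈ regions J₀ W) (g : Finset ι → Finset (Finset ι) → R) :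
    gB J₀ Ys g E = 0 := by
  rw [gB, filter_false_of_mem, sum_empty]
  intro T hT
  rw [not_isMulti_iff J₀ ((isSetPartition_regions J₀ W).nonempty_of_mem hE)]
  exact localI_of_mem_regions J₀ W hJ₀ hE fun Y hY => (mem_polysIn.1 (mem_powerset.1 hT hY)).2

/-- **`g₂ᴬ(□) = g₂(□)` on a single elementary region**: every inner Mayer set keeps it one region, so the background weight of (5.13.4) on an
uncovered region is the full one-region Mayer sum *"g₂(X_α) = Σ_{S_Y,S₅ compatible with X_α} g₁(X_α)"*. [cite: BalabanImbrieJaffe1988, (5.13.4) p.306] -/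
theorem gA_of_mem_regions (hJ₀ : ∀ Y ∈ J₀, Y ⊆ W) {E : Finset ι} (hE : E ∈ regions J₀ W) (g : Finset ι → Finset (Finset ι) → R) :
    gA J₀ Ys g E = g2 Ys g E := by
  rw [gA, g2, filter_true_of_mem]
  intro T hT
  rw [not_isMulti_iff J₀ ((isSetPartition_regions J₀ W).nonempty_of_mem hE)]
  exact localI_of_mem_regions J₀ W hJ₀ hE fun Y hY => (mem_polysIn.1 (mem_powerset.1 hT hY)).2

/-- **(5.13.4), `S`-summed, AS THE TYPED POLYMER GAS**: the Mayer-summed decoupling expansion (left side of (5.13.4), honest bookkeeping of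
`BIJ88Eq5134TwoSpecies.exchange5134`) equals the sum over the compatible families of typed polymers of the weights `g₂ᴬ/g₂ᴮ` times the product
of the one-region Mayer sums `g₂(□)` over the uncovered elementary regions. [cite: BalabanImbrieJaffe1988, (5.13.4) p.306] -/
theorem exchange5134_typedGas (hJ₀ : ∀ Y ∈ J₀, Y ⊆ W) (hYs : ∀ Y ∈ Ys, Y.Nonempty) (g : Finset ι → Finset (Finset ι) → R) :
    ∑ S ∈ (polysIn Ys W).powerset,
        ∑ P ∈ (setPartitions (regions (J₀ ∪ S) W)).filter (IsAdmissible (radj adj)),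
          ∏ K ∈ P, g (K.biUnion id) (restrictTo S (K.biUnion id)) =
      ∑ 𝒳 ∈ (tpolys J₀ W).powerset.filter (IsCompatible (tinc adj)),
        (∏ p ∈ 𝒳, twt (gA J₀ Ys g) (gB J₀ Ys g) p) * ∏ E ∈ uncov J₀ W 𝒳, g2 Ys g E := by
  rw [exchange5134 adj J₀ Ys W hJ₀ hYs g, twoSpecies_eq_typedGas]
  refine sum_congr rfl fun 𝒳 _ => ?_
  congr 1
  exact prod_congr rfl fun E hE => gA_of_mem_regions J₀ Ys W hJ₀ (mem_uncov.1 hE).1 g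

/-- **(5.13.4), `S`-summed, AS `Π_□ g₂(□) · Ξ`** — the form *"z_F = (z_F/z) exp(log z)"* of p. 308 is applied to: over `ℂ`, when the one-region
Mayer sums `g₂(□)` do not vanish, the Mayer-summed decoupling expansion is their product times the `polymerPartitionFunction` of the typed polymers
with the incompatibility `tinc` and the relative activities `g₂^τ(X) / Π_{□ ⊆ X} g₂(□)`. [cite: BalabanImbrieJaffe1988, (5.14.1) p.308] -/
theorem exchange5134_polymerPartitionFunction (hJ₀ : ∀ Y ∈ J₀, Y ⊆ W) (hYs : ∀ Y ∈ Ys, Y.Nonempty) (g : Finset ι → Finset (Finset ι) → ℂ)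
    (hg2 : ∀ E ∈ regions J₀ W, g2 Ys g E ≠ 0) :
    ∑ S ∈ (polysIn Ys W).powerset,
        ∑ P ∈ (setPartitions (regions (J₀ ∪ S) W)).filter (IsAdmissible (radj adj)),
          ∏ K ∈ P, g (K.biUnion id) (restrictTo S (K.biUnion id)) =
      (∏ E ∈ regions J₀ W, g2 Ys g E) *
        polymerPartitionFunction (tinc adj)
          (fun p => twt (gA J₀ Ys g) (gB J₀ Ys g) p * ∏ E ∈ (regions J₀ W).filter (· ⊆ p.1), (g2 Ys g E)⁻¹) (tpolys J₀ W) := by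
  have hu : ∀ E ∈ regions J₀ W, gA J₀ Ys g E * (g2 Ys g E)⁻¹ = 1 := fun E hE => by
    rw [gA_of_mem_regions J₀ Ys W hJ₀ hE g]
    exact mul_inv_cancel₀ (hg2 E hE)
  rw [exchange5134 adj J₀ Ys W hJ₀ hYs g, twoSpecies_eq_polymerPartitionFunction adj J₀ W _ _ _ hu]
  congr 1
  exact prod_congr rfl fun E hE => gA_of_mem_regions J₀ Ys W hJ₀ hE g

end Application

end Literature.MathematicalPhysics.QuantumFieldTheory.BalabanImbrieJaffe1984to88.BIJ88Eq5134PolymerGas
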